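import Literature.NumberTheory.LFunctions.ThetaChainFreeCheck
import HarnessLib

/-!
# Schoenfeld's `θ`-bound on `[599, 10⁸]` by kernel computation: data-free run, chunk 21 of 35

Topic: `Literature/NumberTheory/LFunctions`. Pure proof file (a kernel computation; nothing is
asserted, no definition). The theorems below evaluate `ThetaChain.runFree` — together `150000`
data-free steps of the certified `θ`-chain (`ThetaChain.stepFree`, `ThetaChainFreeCheck.lean`: the
next prime found and certified by two gcds with the primorials of the odd primes `≤ 2999` and in
`(2999, 10007]`, the enclosures of `log p` and `θ(p)`, and the two comparisons behind
`|θ(x) − x| ≤ √x log² x/(8π)`) — from the state at the prime `60595433` to the state at the prime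
`63287621`. Soundness: `ThetaChain.runFree_sound`; assembly of the 35 chunks: `ThetaUpTo1e8.lean`.
The expected states were obtained by evaluating a twin of the same function outside the kernel
(validated bit-for-bit on the tree's chunk `ThetaChainRun.xrun14`). Declarations of `5·10⁴` steps
(about `70 s` of kernel time each; the kernel's evaluation is linear within a declaration of this size),
`decide +kernel`, standard axioms only (`maxHeartbeats 0` lifts the deterministic time-out).

## References

* L. Schoenfeld, *Sharper bounds for the Chebyshev functions θ(x) and ψ(x). II*, Math. Comp. 30
  (1976), 337–360, Thm. 10 (6.3). [Schoenfeld1976]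
* J. B. Rosser, L. Schoenfeld, *Approximate formulas for some functions of prime numbers*,
  Illinois J. Math. 6 (1962), 64–94, Thms. 18–19 (`θ`-tables to `10⁸`). [RosserSchoenfeld1962]
-/

namespace Literature.NumberTheory.LFunctions.ThetaChainRun

open ThetaChain

set_option maxHeartbeats 0 in
/-- **Data-free certified `θ`-run, chunk 21a** (steps `3000001`–`3050000` after `8886113`: 50000 primes,
`60595433` to `61492141`). [cite: Schoenfeld1976, Thm. 10 (6.3)] -/
theorem frun21a :
    runFree 50000
      ⟨60595433, 21663624380478738296445026, 21663624380479213974925688, 73244452711406605854282034792990, 73244452711408315954699862491899⟩ =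
    some ⟨61492141, 21681383320433287060817945, 21681383320433762740249912, 74328077888496920318006622095779, 74328077888498654202372265656733⟩ := by
  decide +kernel

set_option maxHeartbeats 0 in
/-- **Data-free certified `θ`-run, chunk 21b** (steps `3050001`–`3100000` after `8886113`: 50000 primes,
`61492141` to `62389477`). [cite: Schoenfeld1976, Thm. 10 (6.3)] -/
theorem frun21b :
    runFree 50000
      ⟨61492141, 21681383320433287060817945, 21681383320433762740249912, 74328077888496920318006622095779, 74328077888498654202372265656733⟩ =
    some ⟨62389477, 21698897325337578076829630, 21698897325338053757212832, 75412586412278841456906037526846, 75412586412280599125267063333395⟩ := by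
  decide +kernel

set_option maxHeartbeats 0 in
/-- **Data-free certified `θ`-run, chunk 21c** (steps `3100001`–`3150000` after `8886113`: 50000 primes,
`62389477` to `63287621`). [cite: Schoenfeld1976, Thm. 10 (6.3)] -/
theorem frun21c :
    runFree 50000
      ⟨62389477, 21698897325337578076829630, 21698897325338053757212832, 75412586412278841456906037526846, 75412586412280599125267063333395⟩ =
    some ⟨63287621, 21716176654245090775910200, 21716176654245566457244372, 76497964706954146062337160008276, 76497964706955927514741119999650⟩ := by
  decide +kernel

end Literature.NumberTheory.LFunctions.ThetaChainRun
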